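import Summits.QuantumFields.BalabanUV.Beta.GAN24.FibreArrowRowsBloch
import Summits.QuantumFields.BalabanUV.Beta.GAN24.CapacitanceSolve

/-!
# `BalabanUV.Beta.GAN24.FibreArrow` — binder row G-an2-4 / (CONV-C), road P1-fibre, node N04/S1a of `SKELETON-P1.md` (leaf P1-L04c):
# the Bloch fibre system `fibreFun (blochChar p) v = r` IS the ARROW SYSTEM of `GAN24/CapacitanceSolve` in box-DFT coordinates

NOT IN PRINT; OUR PROOF ATTEMPT.  HONEST FRAMING (cell contract, verbatim): «discharging `BetaPertH` makes Bałaban's UV stability UNCONDITIONAL — a real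
constructive-QFT result; it is NOT the continuum limit and NOT the Clay problem.»  HONEST DEPENDENCY (verbatim): «continuum YM on T⁴ ⇐ BetaPertH ∧ nine spine
estimates (0/9 proved); BetaPertH ⇐ (D1) ∧ (D4) ∧ CAP+tail; G-an2-4 gates asym, D1 and NE2/3/4.»  [folklore] finite-dimensional linear algebra / finite Fourier
bookkeeping over `ℂ` (no estimate, no cited fact, no wall binder, no `def … : Prop` fact).  NOT summit progress; nothing of (CONV-C)'s K-slot is discharged here.

## What is proved (generic `D`, `N ≥ 1`, COMPLEX quasi-momentum `p`; `χ = blochChar p`, `k_m = FibreDFT.kFine p m`, `m ∈ (ℤ/N)^D`)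
Box-DFT coordinates of `v : Idx D N → ℂ` (leaf-16's dictionary): `Â = ampA p v`, `μ̂ = ampμ p v`, `φ_κ = v (inr (inr κ))`.  Weights (§1, explicit finite sums,
no estimate): `chiHat p m = amp p 1 m` (χ̂ = N^{−D}S♭), `sflat p m κ = Σ_{s<N} pw(−k_m)(s•e_κ)` (s♭_κ), `boxS p m = Σ_z pw k_m (repZ z)` (S), `boxSs p m κ =
Σ_z Σ_{s<N} pw k_m (repZ z + s•e_κ)` (S·s_κ); sources of a right-hand side `r : Idx D N → ℂ`: `srcEL p r m κ = amp p (r ∘ inl (κ,·)) m`, `srcG p r m = amp p r_G m` with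
`r_G z = [z ≠ 0]·r (inr (inl z))`.
* §2 ROW-WISE DICTIONARY (no hypothesis on `p`): `EL_iff` — the EL rows hold iff `∀ m κ, 2(L_m Â_mκ − ∂̂_mκ(∂̂♭_m·Â_m)) − L_m∂̂_mκ μ̂_m − χ̂_m s♭_κ(m) φ_κ = srcEL`;
  `G_iff` — the G rows (`z ≠ 0`, the «Γ(repZ z) − Γ(0)» differencing) hold iff `∃ c, ∀ m, L_m(∂̂♭_m·Â_m) − χ̂_m c = srcG p r m` (ONE free constant per fibre,
  `c = Γ(0) = Σ_m L_m(∂̂♭_m·Â_m)`; uses `synth p χ̂ = 1`); `M_iff` — `Σ_m S(m) μ̂_m = r_M`; `Q_iff` — `Σ_m (S s_κ)(m) Â_mκ = r_Qκ`.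
* §3 THE PACKAGE: for `p` with all `L_m ≠ 0` (every nonzero REAL `p ∈ (−π,π]^D`, and the strip points of Part A) the data above form leaf-15's
  `CapacitanceSolve.Fibre D (TorusSite D N)` (`aliasFibre p hL`; `∂̂♭_m·∂̂_m = L_m` by `mul_comm`), and
  **`fibreFun_eq_iff_arrowSolves`**: `fibreFun (blochChar p) v = r ↔ ∃ c, ArrowSolves (aliasFibre p hL) (srcEL p r) (srcG p r) (r (inr (inl 0))) (r ∘ inr ∘ inr) Â μ̂ φ c`
  — so `(fibreMatrix (blochChar p)).mulVec v = r` (`BlochFibreMatrix.fibreMatrix_mulVec`) is solved by leaf-15's `arrowSolves_iff` (per-alias `FibreBlockSolve.Asol/musol`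
  + the `(D+1)×(D+1)` capacitance system) and read back through leaf-16's `boxData_inl_eq_sum`/`boxData_inr_eq_sum` — the bordered-inverse programme of leaf P1-L05(b).
The matrix phrasing «`ampMat`-conjugate of `fibreMatrix (blochChar p)` = arrow matrix» of the leaf-table text is this statement read on columns; the `p = 0` fibre
(alias `m = 0` degenerate, `CapacitanceSolveZero.Fibre0`) is §2 verbatim with the `m = 0` rows `−N φ_κ = srcEL p r 0 κ`, `−c = srcG p r 0` (not packaged here).
Unit `b2b-balaban-gan24-formalise-leaf-06` (G-an2-4 formalisation swarm), 2026-08-19.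
-/

noncomputable section

open Complex Finset
open scoped BigOperators
open Literature.MathematicalPhysics.QuantumFieldTheory.Balaban1983to89.Beta
open Literature.MathematicalPhysics.QuantumFieldTheory.LatticeForm (repZ quo)
open Literature.Probability.LatticeModels (TorusSite)
open AffineAveraging (Site Form0 Form1 unitVec)
open BlochFibreMatrix (Idx tens resid blochChar fibreFun repZ_zero)
open Summit.QuantumFields.BalabanUV.Beta.GAN24.FibreSymbols (pw dhat dflat lapSym)
open Summit.QuantumFields.BalabanUV.Beta.GAN24.FibreBlockSolve (dot)
open Summit.QuantumFields.BalabanUV.Beta.GAN24.FibreDFT (kFine amp synth synth_amp amp_synth amp_unique pw_zero_site)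
open Summit.QuantumFields.BalabanUV.Beta.GAN24.FibreDFTDictionary (ampA ampμ)
open Summit.QuantumFields.BalabanUV.Beta.GAN24.FibreArrowRowsBloch (fibreFun_blochChar_EL_modes fibreFun_blochChar_G fibreFun_blochChar_M fibreFun_blochChar_Q)
open Summit.QuantumFields.BalabanUV.Beta.GAN24.CapacitanceSolve (Fibre ArrowSolves ELRows GRows MRow QRows)

namespace Summit.QuantumFields.BalabanUV.Beta.GAN24.FibreArrow

variable {D N : ℕ} [NeZero N]

/-! ## §1 The alias weights and the sources (explicit finite sums; no estimate) -/

/-- [folklore] `χ̂(m) := amp p 1 m` — the twisted box DFT of the constant `1` (`= N^{−D}·Σ_z pw(−k_m)(repZ z) = N^{−D}S♭(m)` of S1a). -/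
def chiHat (p : Fin D → ℂ) (m : TorusSite D N) : ℂ := amp p (1 : TorusSite D N → ℂ) m

/-- [folklore] `s♭_κ(m) := Σ_{s<N} pw(−k_m)(s•e_κ) = Σ_{s<N} e^{−ik_{m,κ}s}` (the reflected contour weight). -/
def sflat (p : Fin D → ℂ) (m : TorusSite D N) (κ : Fin D) : ℂ := ∑ s ∈ Finset.range N, pw (-kFine p m) ((s : ℤ) • unitVec κ)

/-- [folklore] `S(m) := Σ_z pw k_m (repZ z)` (the box factor, weight of `μ̂_m` in the M row). -/
def boxS (p : Fin D → ℂ) (m : TorusSite D N) : ℂ := ∑ z : TorusSite D N, pw (kFine p m) (repZ z)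

/-- [folklore] `(S·s_κ)(m) := Σ_z Σ_{s<N} pw k_m (repZ z + s•e_κ)` (weight of `Â_mκ` in the Q row `κ`). -/
def boxSs (p : Fin D → ℂ) (m : TorusSite D N) (κ : Fin D) : ℂ :=
  ∑ z : TorusSite D N, ∑ s ∈ Finset.range N, pw (kFine p m) (repZ z + (s : ℤ) • unitVec κ)

/-- [folklore] EL source in modes: the box DFT of the EL right-hand side `z ↦ r (inl (κ, z))`. -/
def srcEL (p : Fin D → ℂ) (r : Idx D N → ℂ) (m : TorusSite D N) (κ : Fin D) : ℂ := amp p (fun z => r (Sum.inl (κ, z))) m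

/-- [folklore] The G right-hand side padded by `0` at the M slot `z = 0`. -/
def rG (r : Idx D N → ℂ) (z : TorusSite D N) : ℂ := if z = 0 then 0 else r (Sum.inr (Sum.inl z))

/-- [folklore] G source in modes: the box DFT of `rG r`. -/
def srcG (p : Fin D → ℂ) (r : Idx D N → ℂ) (m : TorusSite D N) : ℂ := amp p (rG r) m

/-- [folklore] `synth` is linear: `synth p (a − c·b) z = synth p a z − c · synth p b z`. -/
theorem synth_sub_mul (p : Fin D → ℂ) (a b : TorusSite D N → ℂ) (c : ℂ) (z : TorusSite D N) :
    synth p (fun m => a m - b m * c) z = synth p a z - c * synth p b z := by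
  unfold synth
  rw [Finset.mul_sum, ← Finset.sum_sub_distrib]
  exact Finset.sum_congr rfl fun m _ => by ring

/-- [folklore] **`synth p χ̂ = 1`**: the block phase is `≡ 1` on the box (`FibreDFT.synth_amp` at the constant `1`). -/
theorem synth_chiHat (p : Fin D → ℂ) (z : TorusSite D N) : synth p (chiHat p) z = 1 := by
  have h := congrFun (synth_amp p (1 : TorusSite D N → ℂ)) z
  exact h

/-- [folklore] `synth p a 0 = Σ_m a m` (all plane waves are `1` at the origin). -/
theorem synth_zero (p : Fin D → ℂ) (a : TorusSite D N → ℂ) : synth p a 0 = ∑ m, a m := by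
  unfold synth
  exact Finset.sum_congr rfl fun m _ => by rw [repZ_zero, pw_zero_site, mul_one]

/-! ## §2 The row-wise dictionary (every complex `p`) -/

/-- [folklore] **EL ROWS ⇔ EL ROWS IN MODES.**  The EL rows `(κ, z)`, `z ∈ (ℤ/N)^D`, of `fibreFun (blochChar p) v = r` hold iff for every alias `m`
`2(L_m Â_mκ − ∂̂_mκ(∂̂♭_m·Â_m)) − L_m ∂̂_mκ μ̂_m − χ̂_m s♭_κ(m) φ_κ = srcEL p r m κ` (the `ELRows` shape of `GAN24/CapacitanceSolve` with `wE = χ̂·s♭`). -/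
theorem EL_iff (p : Fin D → ℂ) (v r : Idx D N → ℂ) (κ : Fin D) :
    (∀ z : TorusSite D N, fibreFun (⇑(blochChar p)) v (Sum.inl (κ, z)) = r (Sum.inl (κ, z)))
      ↔ ∀ m : TorusSite D N,
          (2 * (lapSym (kFine p m) * ampA p v m κ - dhat (kFine p m) κ * dot (dflat (kFine p m)) (ampA p v m))
              - lapSym (kFine p m) * dhat (kFine p m) κ * ampμ p v m)
            - chiHat p m * sflat p m κ * v (Sum.inr (Sum.inr κ)) = srcEL p r m κ := by
  set E : TorusSite D N → ℂ := fun m =>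
    (2 * (lapSym (kFine p m) * ampA p v m κ - dhat (kFine p m) κ * dot (dflat (kFine p m)) (ampA p v m))
        - lapSym (kFine p m) * dhat (kFine p m) κ * ampμ p v m)
      - chiHat p m * sflat p m κ * v (Sum.inr (Sum.inr κ)) with hE
  have hrow : ∀ z : TorusSite D N, fibreFun (⇑(blochChar p)) v (Sum.inl (κ, z)) = synth p E z := fun z => by
    rw [fibreFun_blochChar_EL_modes]; rfl
  constructor
  · intro h m
    have hs : synth p E = fun z => r (Sum.inl (κ, z)) := funext fun z => (hrow z).symm.trans (h z)
    exact congrFun (amp_unique p hs) m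
  · intro h z
    have hE' : E = amp p (fun z => r (Sum.inl (κ, z))) := funext fun m => h m
    rw [hrow z, hE', synth_amp]

/-- [folklore] **G ROWS ⇔ G ROWS IN MODES WITH ONE FREE CONSTANT.**  The G rows `Γ(repZ z) − Γ(0) = r (inr (inl z))`, `z ≠ 0`, hold iff
`∃ c, ∀ m, L_m (∂̂♭_m·Â_m) − χ̂_m c = srcG p r m` — then necessarily `c = Γ(0) = Σ_m L_m (∂̂♭_m·Â_m)` (the block-constant gauge quantity). -/
theorem G_iff (p : Fin D → ℂ) (v r : Idx D N → ℂ) :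
    (∀ z : TorusSite D N, z ≠ 0 → fibreFun (⇑(blochChar p)) v (Sum.inr (Sum.inl z)) = r (Sum.inr (Sum.inl z)))
      ↔ ∃ c : ℂ, ∀ m : TorusSite D N,
          lapSym (kFine p m) * dot (dflat (kFine p m)) (ampA p v m) - chiHat p m * c = srcG p r m := by
  set G : TorusSite D N → ℂ := fun m => lapSym (kFine p m) * dot (dflat (kFine p m)) (ampA p v m) with hG
  -- the G rows are the differenced synthesis of `G`
  have hrow : ∀ z : TorusSite D N, z ≠ 0 →
      fibreFun (⇑(blochChar p)) v (Sum.inr (Sum.inl z)) = synth p G z - synth p G 0 := by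
    intro z hz
    rw [fibreFun_blochChar_G p v hz, synth_zero]
    unfold synth
    rw [← Finset.sum_sub_distrib]
    exact Finset.sum_congr rfl fun m _ => by ring
  -- synthesis of `G − χ̂ c` is `synth G − c`
  have hsyn : ∀ (c : ℂ) (z : TorusSite D N), synth p (fun m => G m - chiHat p m * c) z = synth p G z - c := by
    intro c z
    rw [synth_sub_mul, synth_chiHat, mul_one]
  constructor
  · intro h
    refine ⟨synth p G 0, fun m => ?_⟩
    have hs : synth p (fun m => G m - chiHat p m * synth p G 0) = rG r := by
      funext z
      rw [hsyn]
      by_cases hz : z = 0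
      · subst hz; simp [rG]
      · rw [← hrow z hz, h z hz]; simp [rG, hz]
    exact congrFun (amp_unique p hs) m
  · rintro ⟨c, h⟩ z hz
    have hE : (fun m => G m - chiHat p m * c) = amp p (rG r) := funext fun m => h m
    have hall : ∀ z', synth p G z' - c = rG r z' := fun z' => by rw [← hsyn c z', hE, synth_amp]
    have h0 : synth p G 0 = c := by have := hall 0; simp [rG] at this; linear_combination this
    rw [hrow z hz, h0, hall z]
    simp [rG, hz]

/-- [folklore] **M ROW ⇔** `Σ_m S(m) μ̂_m = r_M`. -/
theorem M_iff (p : Fin D → ℂ) (v r : Idx D N → ℂ) :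
    fibreFun (⇑(blochChar p)) v (Sum.inr (Sum.inl 0)) = r (Sum.inr (Sum.inl 0))
      ↔ ∑ m : TorusSite D N, boxS p m * ampμ p v m = r (Sum.inr (Sum.inl 0)) := by
  rw [fibreFun_blochChar_M]
  unfold boxS
  rw [Finset.sum_congr rfl fun m _ => mul_comm _ _]

/-- [folklore] **Q ROWS ⇔** `∀ κ, Σ_m (S s_κ)(m) Â_mκ = r_Qκ`. -/
theorem Q_iff (p : Fin D → ℂ) (v r : Idx D N → ℂ) (κ : Fin D) :
    fibreFun (⇑(blochChar p)) v (Sum.inr (Sum.inr κ)) = r (Sum.inr (Sum.inr κ))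
      ↔ ∑ m : TorusSite D N, boxSs p m κ * ampA p v m κ = r (Sum.inr (Sum.inr κ)) := by
  rw [fibreFun_blochChar_Q]
  unfold boxSs
  rw [Finset.sum_congr rfl fun m _ => mul_comm _ _]

/-- [folklore] The fibre system splits into its EL / G / M / Q rows. -/
theorem fibreFun_eq_iff_rows (c : Site D → ℂ) (v r : Idx D N → ℂ) :
    fibreFun c v = r ↔
      (∀ κ (z : TorusSite D N), fibreFun c v (Sum.inl (κ, z)) = r (Sum.inl (κ, z))) ∧
      (∀ z : TorusSite D N, z ≠ 0 → fibreFun c v (Sum.inr (Sum.inl z)) = r (Sum.inr (Sum.inl z))) ∧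
      fibreFun c v (Sum.inr (Sum.inl 0)) = r (Sum.inr (Sum.inl 0)) ∧
      (∀ κ, fibreFun c v (Sum.inr (Sum.inr κ)) = r (Sum.inr (Sum.inr κ))) := by
  constructor
  · intro h
    exact ⟨fun κ z => congrFun h _, fun z _ => congrFun h _, congrFun h _, fun κ => congrFun h _⟩
  · rintro ⟨hEL, hG, hM, hQ⟩
    funext i
    rcases i with ⟨κ, z⟩ | (z | κ)
    · exact hEL κ z
    · by_cases hz : z = 0
      · subst hz; exact hM
      · exact hG z hz
    · exact hQ κ

/-! ## §3 The package: leaf-15's `Fibre` on the alias lattice and the arrow system -/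

/-- [folklore] `∂̂♭(k)·∂̂(k) = L(k)` in `FibreBlockSolve.dot` currency. -/
theorem dot_dflat_dhat (k : Fin D → ℂ) : dot (dflat k) (dhat k) = lapSym k := by
  unfold dot lapSym
  exact Finset.sum_congr rfl fun κ _ => mul_comm _ _

/-- [folklore] THE ALIAS FIBRE DATA at quasi-momentum `p` with every alias off the zero mode (`hL : ∀ m, L_m ≠ 0`): symbols `∂̂(k_m)`, `∂̂♭(k_m)`, `L_m`, borders
`wE = χ̂·s♭`, `wG = χ̂`, `wM = S`, `wQ = S·s_κ` — an instance of `GAN24/CapacitanceSolve.Fibre` over the alias lattice `(ℤ/N)^D`. -/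
def aliasFibre (p : Fin D → ℂ) (hL : ∀ m : TorusSite D N, lapSym (kFine p m) ≠ 0) : Fibre D (TorusSite D N) where
  dd m := dhat (kFine p m)
  db m := dflat (kFine p m)
  L m := lapSym (kFine p m)
  wE m κ := chiHat p m * sflat p m κ
  wG m := chiHat p m
  wM m := boxS p m
  wQ m κ := boxSs p m κ
  L_ne := hL
  dot_db_dd m := dot_dflat_dhat (kFine p m)

/-- [folklore] **THE BLOCH FIBRE SYSTEM IS THE ARROW SYSTEM IN BOX-DFT COORDINATES.**  For every right-hand side `r`,
`fibreFun (blochChar p) v = r` iff, for some block gauge constant `c`, the amplitudes `(ampA p v, ampμ p v, v ∘ inr ∘ inr, c)` solve the arrow system of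
`aliasFibre p hL` with sources `(srcEL p r, srcG p r, r (inr (inl 0)), r ∘ inr ∘ inr)`. -/
theorem fibreFun_eq_iff_arrowSolves (p : Fin D → ℂ) (hL : ∀ m : TorusSite D N, lapSym (kFine p m) ≠ 0) (v r : Idx D N → ℂ) :
    fibreFun (⇑(blochChar p)) v = r ↔
      ∃ c : ℂ, ArrowSolves (aliasFibre p hL) (srcEL p r) (srcG p r) (r (Sum.inr (Sum.inl 0))) (fun κ => r (Sum.inr (Sum.inr κ)))
        (ampA p v) (ampμ p v) (fun κ => v (Sum.inr (Sum.inr κ))) c := by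
  rw [fibreFun_eq_iff_rows]
  simp only [ArrowSolves, ELRows, GRows, MRow, QRows, aliasFibre]
  rw [forall_congr' fun κ => EL_iff p v r κ, G_iff p v r, M_iff p v r, forall_congr' fun κ => Q_iff p v r κ]
  constructor
  · rintro ⟨hEL, ⟨c, hG⟩, hM, hQ⟩
    exact ⟨c, fun m κ => hEL κ m, hG, hM, hQ⟩
  · rintro ⟨c, hEL, hG, hM, hQ⟩
    exact ⟨fun κ m => hEL m κ, ⟨c, hG⟩, hM, hQ⟩

/-- [folklore] The same for the fibre MATRIX: `(fibreMatrix (blochChar p)).mulVec v = r` iff the arrow system holds in box-DFT coordinates. -/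
theorem fibreMatrix_mulVec_eq_iff_arrowSolves (p : Fin D → ℂ) (hL : ∀ m : TorusSite D N, lapSym (kFine p m) ≠ 0) (v r : Idx D N → ℂ) :
    (BlochFibreMatrix.fibreMatrix (⇑(blochChar p))).mulVec v = r ↔
      ∃ c : ℂ, ArrowSolves (aliasFibre p hL) (srcEL p r) (srcG p r) (r (Sum.inr (Sum.inl 0))) (fun κ => r (Sum.inr (Sum.inr κ)))
        (ampA p v) (ampμ p v) (fun κ => v (Sum.inr (Sum.inr κ))) c := by
  rw [BlochFibreMatrix.fibreMatrix_mulVec, fibreFun_eq_iff_arrowSolves]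

end Summit.QuantumFields.BalabanUV.Beta.GAN24.FibreArrow

end
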